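import Literature.MathematicalPhysics.QuantumManyBody.LiebYngvasonCellMethod
import HarnessLib

/-!
# No binding from classical stability, II: domination fibrewise over a grid of Neumann cells

Topic `Literature/MathematicalPhysics/QuantumManyBody`, companion of `LiebYngvasonCellMethod.lean`
(the cell method (2.52) of [LSSY2005]) in the service of [Lee2009, Thm. 7]. The cell method bounds
the energy of an `N`-body wave function on the big cube `Λ_{Mℓ}` from below by Neumann-cell
ground-state energies, cell by cell and occupation by occupation. Lee's Theorem 7 needs the same
mechanism one level up, for a *form inequality* rather than an energy floor: if on every Neumann
cube `Λ_ℓ^n` and for every `C¹` `φ`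

  `c ∫_{Λ_ℓ^n} (∑_{i<j} W(|xᵢ-xⱼ|)) |φ|² ≤ ∫_{Λ_ℓ^n} (|∇φ|² + ∑_{i<j} v(|xᵢ-xⱼ|) |φ|²)`   (H)

(`v, W ≥ 0`; for Lee, `W = δ⁻¹ c V₂` and (H) is his Lemma 9), then on the big cube, for every
`C¹` `ψ` of `N` particles,

  `c ∫_{Λ_{Mℓ}^N} (∑_{i<j, same cell} W(|xᵢ-xⱼ|)) |ψ|² ≤ ∫_{Λ_{Mℓ}^N} (|∇ψ|² + ∑_{i<j} v |ψ|²)`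

(`setLIntegral_sameCell_le_boxN`), where "same cell" means that `xᵢ` and `xⱼ` lie in the same
cube of the grid of mesh `ℓ` (`⌊xᵢ/ℓ⌋ = ⌊xⱼ/ℓ⌋` coordinatewise). Proof: on each cell set
`cellSet M ℓ σ` (particle `i` in cell `σ i`) freeze the particles outside a cell, apply (H) to
the slice (`setLIntegral_group_domination`, the form version of
`neumannGroundStateEnergy_mul_le_setLIntegral_group`), sum over the cells
(`kineticDensity_eq_sum_kineticOn`, `sum_interactionOn_le_interaction`, and the identity
`sum_interactionOn_eq_ite` for the `W`-side), and sum over `σ` (`boxN_ae_eq_iUnion_cellSet`).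
No definitions: the same-cell pair sum is written out as an `ite`.

## References

* [Lee2009] J. O. Lee, *Ground state energy of dilute Bose gas in small negative potential
  case*, J. Stat. Phys. 134 (2009) 1–18, arXiv:0803.0533: Lemma 11 and the proof of Thm. 7.
* [LSSY2005] E. H. Lieb, R. Seiringer, J. P. Solovej, J. Yngvason, *The Mathematics of the Bose
  Gas and its Condensation* (2005), (2.52).
-/

noncomputable section

open MeasureTheory Filter Metric
open scoped ENNReal NNReal

namespace Literature.MathematicalPhysics.QuantumManyBody.BoseGas

/-! ### Extracting a group: the form version -/

section Group

variable {n N : ℕ}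

/-- **Group extraction, form version.** Let `ι : Fin n ↪ Fin N` single out `n` of the `N`
particles, confined to the translated cube `u + Λ_ℓ`, the others constrained to a measurable set
`A`. If the cube inequality `c ∫_{Λ_ℓ^n} (∑W)|φ|² ≤ ∫_{Λ_ℓ^n} (|∇φ|² + (∑v)|φ|²)` holds for
every `C¹` `φ` of `n` particles, then on this region the same inequality holds for the group's
share of any `C¹` `ψ` of `N` particles (freeze the others, translate, Tonelli).
[cite: Lee2009, Lemma 11] -/
theorem setLIntegral_group_domination (ι : Fin n ↪ Fin N) (u : Space) (ℓ : ℝ)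
    {v W : ℝ → ℝ≥0∞} (hv : Measurable v) (hW : Measurable W) {ψ : Config N → ℂ}
    (hψ : ContDiff ℝ 1 ψ) (A : Set ({j // j ∉ Set.range ι} → Space)) {c : ℝ≥0∞}
    (hbox : ∀ φ : Config n → ℂ, ContDiff ℝ 1 φ →
      c * ∫⁻ Y in boxN n ℓ, interaction W Y * (‖φ Y‖₊ : ℝ≥0∞) ^ 2 ≤
        ∫⁻ Y in boxN n ℓ, kineticDensity φ Y + interaction v Y * (‖φ Y‖₊ : ℝ≥0∞) ^ 2) :
    c * ∫⁻ X in {X | (∀ i, X (ι i) - u ∈ box ℓ) ∧ (fun j : {j // j ∉ Set.range ι} => X j) ∈ A},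
          interactionOn ι W X * (‖ψ X‖₊ : ℝ≥0∞) ^ 2 ≤
      ∫⁻ X in {X | (∀ i, X (ι i) - u ∈ box ℓ) ∧ (fun j : {j // j ∉ Set.range ι} => X j) ∈ A},
        kineticOn ι ψ X + interactionOn ι v X * (‖ψ X‖₊ : ℝ≥0∞) ^ 2 := by
  set T := {X : Config N | (∀ i, X (ι i) - u ∈ box ℓ) ∧
    (fun j : {j // j ∉ Set.range ι} => X j) ∈ A} with hT_def
  set g := glueEquiv ι u with hg_def
  have hg := volume_preserving_glueEquiv ι u
  have hT : g ⁻¹' T = boxN n ℓ ×ˢ A := by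
    ext ⟨Y, Z⟩
    have hZ : (fun j : {j // j ∉ Set.range ι} => glueEquiv ι u (Y, Z) j) = Z :=
      funext fun j => glueEquiv_apply_of_not_mem ι u Y Z j j.2
    simp only [hT_def, hg_def, Set.mem_preimage, Set.mem_setOf_eq, glueEquiv_apply_ι,
      add_sub_cancel_left, hZ, Set.mem_prod, boxN]
  have hcv : ∀ F : Config N → ℝ≥0∞,
      ∫⁻ X in T, F X = ∫⁻ p in boxN n ℓ ×ˢ A, F (g p) ∂(volume.prod volume) := by
    intro F
    rw [← hT, ← Measure.volume_eq_prod]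
    exact (hg.setLIntegral_comp_preimage_emb g.measurableEmbedding F T).symm
  have hn2 : Measurable fun X => (‖ψ X‖₊ : ℝ≥0∞) ^ 2 := measurable_normSq hψ.continuous
  have hF : Measurable fun X => kineticOn ι ψ X + interactionOn ι v X * (‖ψ X‖₊ : ℝ≥0∞) ^ 2 :=
    (measurable_kineticOn ι hψ).add ((measurable_interactionOn ι hv).mul hn2)
  have hG : Measurable fun X => interactionOn ι W X * (‖ψ X‖₊ : ℝ≥0∞) ^ 2 :=
    (measurable_interactionOn ι hW).mul hn2
  rw [hcv, hcv,
    setLIntegral_prod_symm (fun p => interactionOn ι W (g p) * (‖ψ (g p)‖₊ : ℝ≥0∞) ^ 2)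
      (hG.comp g.measurable).aemeasurable,
    setLIntegral_prod_symm (fun p => kineticOn ι ψ (g p) + interactionOn ι v (g p) *
      (‖ψ (g p)‖₊ : ℝ≥0∞) ^ 2) (hF.comp g.measurable).aemeasurable]
  refine le_trans (lintegral_const_mul_le _ _) (lintegral_mono fun Z => ?_)
  -- a frozen configuration `Z` of the other particles: the slice
  have key := hbox (slice ι u ψ Z) (contDiff_slice ι u hψ Z)
  refine le_trans (le_of_eq ?_) (key.trans (le_of_eq (lintegral_congr fun Y => ?_)))
  · congr 1
    refine lintegral_congr fun Y => ?_
    rw [interaction_eq_interactionOn_glueEquiv ι u W Z Y]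
    rfl
  · rw [kineticDensity_slice ι u hψ Z Y, interaction_eq_interactionOn_glueEquiv ι u v Z Y]
    rfl

end Group

/-! ### The same-cell pair sum -/

section Cells

variable {N M : ℕ}

/-- Grouping the particles by a labelling `σ`: the sum over the groups of the interactions
inside the groups is the sum over the pairs `i < j` with `σ i = σ j`. [cite: LSSY2005, (2.52)] -/
theorem sum_interactionOn_eq_ite {K : ℕ} (σ : Fin N → Fin K) (W : ℝ → ℝ≥0∞) (X : Config N) :
    ∑ c : Fin K, interactionOn ((Finset.univ.filter fun i => σ i = c).orderEmbOfFin rfl) W X =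
      ∑ i : Fin N, ∑ j : Fin N with i < j,
        if σ i = σ j then W (dist (X i) (X j)) else 0 := by
  unfold interactionOn interaction
  have key : ∀ c : Fin K,
      (∑ i : Fin (Finset.univ.filter fun i => σ i = c).card,
        ∑ j : Fin (Finset.univ.filter fun i => σ i = c).card with i < j,
          W (dist (X ((Finset.univ.filter fun i => σ i = c).orderEmbOfFin rfl i))
            (X ((Finset.univ.filter fun i => σ i = c).orderEmbOfFin rfl j)))) =
      ∑ i ∈ Finset.univ.filter (fun i => σ i = c),
        ∑ j ∈ Finset.univ.filter (fun i => σ i = c) with i < j, W (dist (X i) (X j)) := by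
    intro c
    set s := Finset.univ.filter fun i => σ i = c
    set e := s.orderIsoOfFin rfl
    have inner : ∀ i : Fin s.card,
        (∑ j : Fin s.card with i < j,
            W (dist (X (s.orderEmbOfFin rfl i)) (X (s.orderEmbOfFin rfl j))))
          = ∑ j ∈ s with (s.orderEmbOfFin rfl i : Fin N) < j,
              W (dist (X (s.orderEmbOfFin rfl i)) (X j)) := by
      intro i
      rw [Finset.sum_filter, Finset.sum_filter, ← Finset.sum_coe_sort s]
      refine Fintype.sum_equiv e.toEquiv _ _ fun j => ?_
      have : (i < j) ↔ ((s.orderEmbOfFin rfl i : Fin N) < (e j : Fin N)) := by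
        rw [← Finset.coe_orderIsoOfFin_apply]
        exact (e.lt_iff_lt).symm.trans Iff.rfl |>.trans (by norm_cast)
      simp only [this]
      rfl
    simp_rw [inner]
    rw [← Finset.sum_coe_sort s]
    refine Fintype.sum_equiv e.toEquiv _ _ fun i => ?_
    rfl
  simp_rw [key]
  -- on the fibre of `c`, replace `c` by `σ i`, then sum fibrewise
  have hfib : ∀ c : Fin K,
      (∑ i ∈ Finset.univ.filter (fun i => σ i = c),
        ∑ j ∈ Finset.univ.filter (fun i => σ i = c) with i < j, W (dist (X i) (X j))) =
      ∑ i ∈ Finset.univ.filter (fun i => σ i = c),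
        ∑ j : Fin N with i < j, if σ i = σ j then W (dist (X i) (X j)) else 0 := by
    intro c
    refine Finset.sum_congr rfl fun i hi => ?_
    have hic : σ i = c := (Finset.mem_filter.1 hi).2
    rw [Finset.sum_filter, Finset.sum_filter, Finset.sum_filter]
    refine Finset.sum_congr rfl fun j _ => ?_
    by_cases hj : σ j = c
    · rw [if_pos hj, hic, if_pos hj.symm]
    · rw [if_neg hj, hic, if_neg (Ne.symm hj)]
      split_ifs <;> rfl
  simp_rw [hfib]
  exact Finset.sum_fiberwise Finset.univ σ _

/-- On the cell set of `σ`, the grid cube of particle `i` is `σ i`: `⌊x_{i,k}/ℓ⌋` is the `k`-th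
lattice coordinate of the cell `σ i`. [cite: LSSY2005, (2.52)] -/
theorem floor_div_eq_cellCoord_of_mem_cellSet {ℓ : ℝ} (hℓ : 0 < ℓ) {σ : Fin N → Fin (M ^ 3)}
    {X : Config N} (hX : X ∈ cellSet M ℓ σ) (i : Fin N) (k : Fin 3) :
    ⌊X i k / ℓ⌋ = ((cellCoord M (σ i) k : ℕ) : ℤ) := by
  have h := hX i k
  simp only [PiLp.sub_apply, cellCorner_apply, Set.mem_Ioo] at h
  rw [Int.floor_eq_iff]
  push_cast
  constructor
  · rw [le_div_iff₀ hℓ]; linarith [h.1]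
  · rw [div_lt_iff₀ hℓ]; linarith [h.2]

/-- On the cell set of `σ`, two particles share a grid cube iff they carry the same label.
[cite: LSSY2005, (2.52)] -/
theorem sameCell_iff_of_mem_cellSet {ℓ : ℝ} (hℓ : 0 < ℓ) {σ : Fin N → Fin (M ^ 3)}
    {X : Config N} (hX : X ∈ cellSet M ℓ σ) (i j : Fin N) :
    (∀ k : Fin 3, ⌊X i k / ℓ⌋ = ⌊X j k / ℓ⌋) ↔ σ i = σ j := by
  simp only [floor_div_eq_cellCoord_of_mem_cellSet hℓ hX, Nat.cast_inj]
  constructor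
  · intro h
    have : cellCoord M (σ i) = cellCoord M (σ j) := funext fun k => Fin.ext (h k)
    exact finFunctionFinEquiv.symm.injective this
  · intro h k
    rw [h]

/-- **Domination on a cell set.** Under the cube inequality (H) for every occupation number,
on each cell set `cellSet M ℓ σ` the same-cell `W`-pair form of a `C¹` `ψ` is dominated by
its energy density with `v`: `c ∫ (∑_{i<j, same cube} W)|ψ|² ≤ ∫ (|∇ψ|² + (∑v)|ψ|²)`.
[cite: Lee2009, Lemma 11] -/
theorem setLIntegral_sameCell_le_cellSet {ℓ : ℝ} (hℓ : 0 < ℓ) {v W : ℝ → ℝ≥0∞}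
    (hv : Measurable v) (hW : Measurable W) {ψ : Config N → ℂ} (hψ : ContDiff ℝ 1 ψ)
    (σ : Fin N → Fin (M ^ 3)) {c : ℝ≥0∞}
    (hbox : ∀ (n : ℕ) (φ : Config n → ℂ), ContDiff ℝ 1 φ →
      c * ∫⁻ Y in boxN n ℓ, interaction W Y * (‖φ Y‖₊ : ℝ≥0∞) ^ 2 ≤
        ∫⁻ Y in boxN n ℓ, kineticDensity φ Y + interaction v Y * (‖φ Y‖₊ : ℝ≥0∞) ^ 2) :
    c * ∫⁻ X in cellSet M ℓ σ, (∑ i : Fin N, ∑ j : Fin N with i < j,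
        if (∀ k : Fin 3, ⌊X i k / ℓ⌋ = ⌊X j k / ℓ⌋) then W (dist (X i) (X j)) else 0) *
          (‖ψ X‖₊ : ℝ≥0∞) ^ 2 ≤
      ∫⁻ X in cellSet M ℓ σ, kineticDensity ψ X + interaction v X * (‖ψ X‖₊ : ℝ≥0∞) ^ 2 := by
  have hn2 : Measurable fun X => (‖ψ X‖₊ : ℝ≥0∞) ^ 2 := measurable_normSq hψ.continuous
  -- on the cell set, the same-cell sum is the sum over the groups
  have hcongr : ∫⁻ X in cellSet M ℓ σ, (∑ i : Fin N, ∑ j : Fin N with i < j,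
        if (∀ k : Fin 3, ⌊X i k / ℓ⌋ = ⌊X j k / ℓ⌋) then W (dist (X i) (X j)) else 0) *
          (‖ψ X‖₊ : ℝ≥0∞) ^ 2 =
      ∫⁻ X in cellSet M ℓ σ, ∑ c : Fin (M ^ 3),
        interactionOn ((Finset.univ.filter fun i => σ i = c).orderEmbOfFin rfl) W X *
          (‖ψ X‖₊ : ℝ≥0∞) ^ 2 := by
    refine setLIntegral_congr_fun (measurableSet_cellSet M ℓ σ) fun X hX => ?_
    rw [← Finset.sum_mul, sum_interactionOn_eq_ite]
    congr 1
    refine Finset.sum_congr rfl fun i _ => Finset.sum_congr rfl fun j _ => ?_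
    simp only [sameCell_iff_of_mem_cellSet hℓ hX]
  have hc : ∀ c' : Fin (M ^ 3),
      c * ∫⁻ X in cellSet M ℓ σ,
          interactionOn ((Finset.univ.filter fun i => σ i = c').orderEmbOfFin rfl) W X *
            (‖ψ X‖₊ : ℝ≥0∞) ^ 2 ≤
        ∫⁻ X in cellSet M ℓ σ,
          kineticOn ((Finset.univ.filter fun i => σ i = c').orderEmbOfFin rfl) ψ X +
            interactionOn ((Finset.univ.filter fun i => σ i = c').orderEmbOfFin rfl) v X *
              (‖ψ X‖₊ : ℝ≥0∞) ^ 2 := by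
    intro c'
    have h := setLIntegral_group_domination
      ((Finset.univ.filter fun i => σ i = c').orderEmbOfFin rfl).toEmbedding (cellCorner M ℓ c')
      ℓ hv hW hψ {Z | ∀ j, Z j - cellCorner M ℓ (σ j) ∈ box ℓ} (hbox _)
    rw [setOf_group_eq_cellSet M ℓ σ c'] at h
    exact h
  rw [hcongr, lintegral_finsetSum Finset.univ
    (f := fun c' X => interactionOn ((Finset.univ.filter fun i => σ i = c').orderEmbOfFin rfl) W X *
      (‖ψ X‖₊ : ℝ≥0∞) ^ 2)
    fun c' _ => (measurable_interactionOn _ hW).mul hn2, Finset.mul_sum]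
  refine (Finset.sum_le_sum fun c' _ => hc c').trans ?_
  rw [← lintegral_finsetSum Finset.univ
    (f := fun c' X => kineticOn ((Finset.univ.filter fun i => σ i = c').orderEmbOfFin rfl) ψ X +
      interactionOn ((Finset.univ.filter fun i => σ i = c').orderEmbOfFin rfl) v X *
        (‖ψ X‖₊ : ℝ≥0∞) ^ 2)
    fun c' _ => (measurable_kineticOn _ hψ).add ((measurable_interactionOn _ hv).mul hn2)]
  refine lintegral_mono fun X => ?_
  rw [Finset.sum_add_distrib, ← Finset.sum_mul, ← kineticDensity_eq_sum_kineticOn σ ψ X]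
  gcongr
  exact sum_interactionOn_le_interaction σ v X

/-- **Domination on the big cube (Lee's Lemma 11, form version).** Let `M ≥ 1`, `ℓ > 0`, and
suppose the cube inequality (H): `c ∫_{Λ_ℓ^n} (∑W)|φ|² ≤ ∫_{Λ_ℓ^n} (|∇φ|² + (∑v)|φ|²)` for
every `n` and every `C¹` `φ`. Then for every `C¹` `ψ` of `N` particles on `Λ_{Mℓ}^N`,
`c ∫ (∑_{i<j, ⌊xᵢ/ℓ⌋ = ⌊xⱼ/ℓ⌋} W(|xᵢ-xⱼ|)) |ψ|² ≤ ∫ (|∇ψ|² + ∑_{i<j} v(|xᵢ-xⱼ|)|ψ|²)`: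
only pairs in a common grid cube are kept on the left ("`V_α = ∑ δ_{α_i α_j} V`"), all pairs on
the right (`v ≥ 0`). [cite: Lee2009, Lemma 11] -/
theorem setLIntegral_sameCell_le_boxN (hM : 0 < M) {ℓ : ℝ} (hℓ : 0 < ℓ) {v W : ℝ → ℝ≥0∞}
    (hv : Measurable v) (hW : Measurable W) {ψ : Config N → ℂ} (hψ : ContDiff ℝ 1 ψ)
    {c : ℝ≥0∞}
    (hbox : ∀ (n : ℕ) (φ : Config n → ℂ), ContDiff ℝ 1 φ →
      c * ∫⁻ Y in boxN n ℓ, interaction W Y * (‖φ Y‖₊ : ℝ≥0∞) ^ 2 ≤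
        ∫⁻ Y in boxN n ℓ, kineticDensity φ Y + interaction v Y * (‖φ Y‖₊ : ℝ≥0∞) ^ 2) :
    c * ∫⁻ X in boxN N (M * ℓ), (∑ i : Fin N, ∑ j : Fin N with i < j,
        if (∀ k : Fin 3, ⌊X i k / ℓ⌋ = ⌊X j k / ℓ⌋) then W (dist (X i) (X j)) else 0) *
          (‖ψ X‖₊ : ℝ≥0∞) ^ 2 ≤
      ∫⁻ X in boxN N (M * ℓ), kineticDensity ψ X + interaction v X * (‖ψ X‖₊ : ℝ≥0∞) ^ 2 := by
  rw [setLIntegral_congr (boxN_ae_eq_iUnion_cellSet (N := N) hℓ hM),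
    setLIntegral_congr (boxN_ae_eq_iUnion_cellSet (N := N) hℓ hM),
    lintegral_iUnion (fun σ => measurableSet_cellSet M ℓ σ) (pairwiseDisjoint_cellSet hℓ),
    lintegral_iUnion (fun σ => measurableSet_cellSet M ℓ σ) (pairwiseDisjoint_cellSet hℓ),
    tsum_fintype, tsum_fintype, Finset.mul_sum]
  exact Finset.sum_le_sum fun σ _ => setLIntegral_sameCell_le_cellSet hℓ hv hW hψ σ hbox

end Cells

end Literature.MathematicalPhysics.QuantumManyBody.BoseGas

end
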